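import Literature.MathematicalPhysics.QuantumLattice.HubbardThermalPseudospinIsotropy
import HarnessLib

/-!
# Kubo–Kishi (6): the on-site pairing susceptibility of the half-filled repulsive Hubbard model is
# bounded by `1/(2U)` at every temperature — the Duhamel (Ward-identity) form of Zhang's pseudospin isotropy

Trunk T-QLATTICE (family `hubbard`). K. Kubo, T. Kishi, *Rigorous bounds on the susceptibilities of the
Hubbard model*, Phys. Rev. B **41** (1990) 4866–4868, Theorem 2, eq. (6) and its proof ("the pairing operator
`p_α` is transformed to `η_α S⁺_α`. The rotational invariance of `H̃` in the spin space and Theorem 1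
immediately leads to inequality (6)") [KuboKishi1990]; S.-C. Zhang, Phys. Rev. Lett. **65** (1990) 120
(pseudospin `SU(2)`) [Zhang1990]; C. N. Yang, S.-C. Zhang, Mod. Phys. Lett. B **4** (1990) 759, Theorem 1
[YangZhang1990]; F. J. Dyson, E. H. Lieb, B. Simon, J. Stat. Phys. **18** (1978) 335, §3 eq. (5) (the Duhamel
two-point function) [DLS1978].

The companion file `HubbardThermalPseudospinIsotropy` proves the EQUAL-TIME isotropy
`⟨(n_x - 1)(n_y - 1)⟩_{β,K} = 2 ε_x ε_y ⟨Δ†_x Δ_y⟩_{β,K}` (`x ≠ y`) in every Gibbs state of a `K` commuting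
with Yang's `η†_ε`. Here the same rotation is carried out for the DUHAMEL two-point function
`(A, B)_{β,K} = Z⁻¹ ∫₀¹ tr(A e^{-sβK} B e^{-(1-s)βK}) ds` (`Matrix.duhamel`), i.e. for susceptibilities, which
is the step Kubo–Kishi use to pass from their charge bound (5) to their pairing bound (6):

* §0 the **Ward identity** of the Duhamel function: if `Q K = K Q` then
  `([Q, A], B)_{β,K} = -(A, [Q, B])_{β,K}` (`duhamel_commutator_left_eq_neg`; cyclicity of the trace and
  `[Q, e^{-sβK}] = 0`, pointwise in `s` — `trace_commutator_sandwich_eq_neg`);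
* §1 the two elementary commutators with `η†_ε = Σ_z ε_z Δ†_z` as OPERATOR identities:
  `[n_x - 1, η†_ε] = 2 ε_x Δ†_x` (`chargeDev_commutator_etaRaise`) and `[Δ_y, η†_ε] = -ε_y (n_y - 1)`
  (`pairAnnihilation_commutator_etaRaise`) (Yang 1989 eq. (4); Yang–Zhang 1990 Theorem 1);
* §2 **Duhamel pseudospin isotropy**: for `W₁`, `W₂` commuting with `η†_ε` and ALL sites `x`, `y`
  (including `x = y` — the Duhamel function is symmetrised, no contact term)
  `tr((n_x - 1) W₁ (n_y - 1) W₂) = 2 ε_x ε_y tr(Δ†_x W₁ Δ_y W₂)` (`trace_chargeDev_sandwich_eq`), summed with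
  real profiles `tr(F_a W₁ F_b W₂) = 2 tr(P†_{aε} W₁ P_{bε} W₂)`, `P_c = Σ_y c_y Δ_y`, and hence
  `(F_a, F_b)_{β,K} = 2 (P†_{aε}, P_{bε})_{β,K}` whenever `η†_ε K = K η†_ε`
  (`duhamel_chargeDensityField_eq_two_mul_pair`); in particular `(F_ε, F_ε) = 2 (η†_1, η_1)`;
* §3 **Kubo–Kishi (6), PROVED from the named fact `kuboKishi_charge_gaussianDomination`** (their charge
  Gaussian domination, the hypothesis behind (5) in the tree): for `U > 0`, `μ = U/2`, a bipartite sign,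
  `β > 0` and every real profile `c`,
  `Re (P†_c, P_c)_β ≤ Σ_x c_x² /(2βU)` (`kuboKishi_pairing_duhamel_le`) — with `c_x = |Λ|^{-1/2} cos(q·x)`,
  `sin(q·x)` this is the on-site pairing susceptibility bound `β(p_q, p_{-q}) ≤ const/U` of their eq. (6) at
  every wave vector (the rotation gives the constant `1/2`: both transverse components of the rotated
  pseudospin obey (10), `(S⁺, S⁻) = (Sˣ, Sˣ) + (Sʸ, Sʸ)`; Kubo–Kishi print `U⁻¹`); the uniform case
  `Re (η†_1, η_1)_β ≤ |Λ|/(2βU)` (`kuboKishi_uniformPairing_duhamel_le`) and its torus form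
  (`kuboKishi_uniformPairing_duhamel_le_torus`, every dimension `d`, even `L`).

Honest scope: finite graphs, the grand-canonical Gibbs state at `μ = U/2` (half filling), nearest-neighbour
real hopping, where the `η`-symmetry is exact; an UPPER bound on the uniform/finite-`q` on-site (`s`-wave)
pair susceptibility, uniform in temperature and volume and decreasing in `U`; conditional on the published
Kubo–Kishi Gaussian domination exactly as the tree's (5); nothing here bears on `d`-wave pairing or on the
doped model.
-/

noncomputable section

open scoped Matrix.Norms.L2Operator ComplexOrder
open Finset MeasureTheory intervalIntegral

namespace Literature.MathematicalPhysics.QuantumLattice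

open Matrix

/-! ### §0 The Ward identity of the Duhamel two-point function -/

section Ward

variable {n : Type*} [Fintype n] [DecidableEq n]

omit [DecidableEq n] in
/-- Pointwise (fixed Gibbs weights) form of the Ward identity: if `W₁`, `W₂` commute with `Q` then
`tr([Q, A] W₁ B W₂) = -tr(A W₁ [Q, B] W₂)` (cyclicity of the trace; the integrand of the Duhamel function of
[DLS1978] §3 eq. (5) for a conserved `Q`). [cite: DLS1978, §3 eq. (5)] -/
theorem trace_commutator_sandwich_eq_neg {Q W₁ W₂ : Matrix n n ℂ} (h₁ : W₁ * Q = Q * W₁)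
    (h₂ : W₂ * Q = Q * W₂) (A B : Matrix n n ℂ) :
    ((Q * A - A * Q) * W₁ * B * W₂).trace = -(A * W₁ * (Q * B - B * Q) * W₂).trace := by
  have e1 : (Q * A * W₁ * B * W₂).trace = (A * W₁ * (B * Q) * W₂).trace := by
    calc (Q * A * W₁ * B * W₂).trace = (Q * (A * W₁ * B * W₂)).trace := by
          simp only [Matrix.mul_assoc]
      _ = (A * W₁ * B * W₂ * Q).trace := trace_mul_comm _ _
      _ = (A * W₁ * (B * Q) * W₂).trace := by
          rw [Matrix.mul_assoc (A * W₁ * B) W₂ Q, h₂, ← Matrix.mul_assoc (A * W₁ * B) Q W₂,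
            Matrix.mul_assoc (A * W₁) B Q]
  have e2 : (A * Q * W₁ * B * W₂).trace = (A * W₁ * (Q * B) * W₂).trace := by
    rw [Matrix.mul_assoc A Q W₁, ← h₁, ← Matrix.mul_assoc A W₁ Q, Matrix.mul_assoc (A * W₁) Q B]
  simp only [Matrix.sub_mul, Matrix.mul_sub, trace_sub]
  rw [e1, e2]
  ring

/-- **Ward identity for the Duhamel two-point function.** If `Q` commutes with `K` then for all `A`, `B`
and every `β`, `([Q, A], B)_{β,K} = -(A, [Q, B])_{β,K}` — the Gibbs weights `e^{-sβK}` commute with `Q`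
(`Commute.exp_left`) and the trace is cyclic, pointwise under the Duhamel integral. (Equivalently
`([Q, A], B) + (A, [Q, B]) = 0`: the Duhamel inner product is invariant under the one-parameter group
generated by a conserved `Q`.) [cite: DLS1978, §3 eq. (5)] -/
theorem duhamel_commutator_left_eq_neg {K Q : Matrix n n ℂ} (hQ : Q * K = K * Q) (β : ℝ)
    (A B : Matrix n n ℂ) :
    duhamel β K (Q * A - A * Q) B = -duhamel β K A (Q * B - B * Q) := by
  have hc : ∀ t : ℝ, gibbsWeight t K * Q = Q * gibbsWeight t K := fun t =>
    ((Commute.smul_left (show Commute K Q from hQ.symm) (-(t : ℂ))).exp_left).eq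
  unfold duhamel
  rw [← mul_neg, ← intervalIntegral.integral_neg]
  congr 1
  refine intervalIntegral.integral_congr fun s _ => ?_
  exact trace_commutator_sandwich_eq_neg (hc _) (hc _) A B

/-- Plumbing: an identity between Duhamel integrands, pointwise in `s`, integrates to the same identity
between Duhamel functions (`∫ c f = c ∫ f`). [folklore] -/
private theorem duhamel_eq_mul_of_forall_trace_eq {K A B A' B' : Matrix n n ℂ} {c : ℂ} {β : ℝ}
    (h : ∀ s : ℝ, (A * gibbsWeight (s * β) K * B * gibbsWeight ((1 - s) * β) K).trace =
      c * (A' * gibbsWeight (s * β) K * B' * gibbsWeight ((1 - s) * β) K).trace) :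
    duhamel β K A B = c * duhamel β K A' B' := by
  unfold duhamel
  have hI : (∫ s in (0 : ℝ)..1, (A * gibbsWeight (s * β) K * B * gibbsWeight ((1 - s) * β) K).trace) =
      ∫ s in (0 : ℝ)..1, c * (A' * gibbsWeight (s * β) K * B' * gibbsWeight ((1 - s) * β) K).trace :=
    intervalIntegral.integral_congr fun s _ => h s
  rw [hI, intervalIntegral.integral_const_mul]
  ring

end Ward

/-! ### §1 The commutators `[n_x - 1, η†_ε] = 2 ε_x Δ†_x` and `[Δ_y, η†_ε] = -ε_y (n_y - 1)` -/

section CAR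

variable {Λ : Type*} [LinearOrder Λ] [Fintype Λ]

/-- `n_{xσ}` is diagonal in the occupation basis. [folklore] -/
private theorem numberOp_mulVec_apply_ind (x : Λ) (σ : Fin 2) (f : Fock (Orb Λ)) (s : Finset (Orb Λ)) :
    (numberOp x σ *ᵥ f) s = (if orb x σ ∈ s then 1 else 0) * f s := by
  rw [← numberAt_orb, numberAt_eq_diagonal, mulVec_diagonal]

/-- `ε ε = 1` in `ℂ` for a sign `ε ∈ ℤˣ`. [folklore] -/
private theorem sign_intCast_mul_self (u : ℤˣ) : ((u : ℤ) : ℂ) * ((u : ℤ) : ℂ) = 1 := by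
  rw [← Int.cast_mul, Int.units_coe_mul_self, Int.cast_one]

/-- `[n_x - 1, Δ†_z] = 2 δ_{xz} Δ†_z` (`[n_{xσ}, c†_{z↑} c†_{z↓}] = (δ + δ) c†c†`, `number_pair_commutator`).
Yang, PRL 63 (1989) 2144, eq. (4). [cite: Yang1989, eq. (4)] -/
theorem chargeDev_commutator_pairCreation (x z : Λ) :
    (numberOp x 0 + numberOp x 1 - 1) * (creation (orb z 0) * creation (orb z 1)) -
        creation (orb z 0) * creation (orb z 1) * (numberOp x 0 + numberOp x 1 - 1) =
      if x = z then (2 : ℂ) • (creation (orb z 0) * creation (orb z 1)) else 0 := by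
  have h0 := number_pair_commutator (orb x 0) (orb z 0) (orb z 1)
  have h1 := number_pair_commutator (orb x 1) (orb z 0) (orb z 1)
  have split : (numberOp x 0 + numberOp x 1 - 1) * (creation (orb z 0) * creation (orb z 1)) -
        creation (orb z 0) * creation (orb z 1) * (numberOp x 0 + numberOp x 1 - 1) =
      (numberOp x 0 * (creation (orb z 0) * creation (orb z 1)) -
          creation (orb z 0) * creation (orb z 1) * numberOp x 0) +
        (numberOp x 1 * (creation (orb z 0) * creation (orb z 1)) -
          creation (orb z 0) * creation (orb z 1) * numberOp x 1) := by
    noncomm_ring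
  rw [split, numberOp, numberOp, h0, h1]
  by_cases hxz : x = z
  · subst hxz
    rw [if_pos rfl, if_neg (EtaPairingODLRO.orb_zero_ne_orb_one x),
      if_neg (EtaPairingODLRO.orb_zero_ne_orb_one x).symm, if_pos rfl, if_pos rfl, add_zero, zero_add,
      two_smul]
  · rw [if_neg (EtaPairingODLRO.orb_ne_orb_of_ne hxz 0 0), if_neg (EtaPairingODLRO.orb_ne_orb_of_ne hxz 0 1),
      if_neg (EtaPairingODLRO.orb_ne_orb_of_ne hxz 1 0), if_neg (EtaPairingODLRO.orb_ne_orb_of_ne hxz 1 1),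
      if_neg hxz, add_zero, add_zero]

/-- **`[n_x - 1, η†_ε] = 2 ε_x Δ†_x`** (only the term `z = x` of `η†_ε = Σ_z ε_z Δ†_z` fails to commute
with `n_x`; `Δ†_x` raises `n_x` by two). Yang, PRL 63 (1989) 2144, eq. (4); Yang–Zhang, Mod. Phys. Lett.
B 4 (1990) 759, Theorem 1. [cite: Yang1989, eq. (4)] -/
theorem chargeDev_commutator_etaRaise (ε : Λ → ℤˣ) (x : Λ) :
    (numberOp x 0 + numberOp x 1 - 1) * etaRaise ε - etaRaise ε * (numberOp x 0 + numberOp x 1 - 1) =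
      (2 * ((ε x : ℤ) : ℂ)) • (creation (orb x 0) * creation (orb x 1)) := by
  rw [commutator_etaRaise]
  simp_rw [chargeDev_commutator_pairCreation]
  rw [Finset.sum_eq_single x (fun z _ hz => by rw [if_neg (Ne.symm hz), smul_zero])
    (fun h => absurd (Finset.mem_univ x) h), if_pos rfl, smul_smul, mul_comm]

/-- `[Δ_y, Δ†_z] = -δ_{yz} (n_y - 1)`: pair operators at distinct sites commute
(`EtaPairingODLRO.pairAnnihilation_pairCreation_comm`), and on one site
`Δ_y Δ†_y - Δ†_y Δ_y = 1 - n_{y↑} - n_{y↓}` (`EtaPairingODLRO.pairAnnihilation_pairCreation_self`).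
Yang–Zhang, Mod. Phys. Lett. B 4 (1990) 759, Theorem 1. [cite: YangZhang1990, Theorem 1] -/
theorem pairAnnihilation_commutator_pairCreation (y z : Λ) :
    annihilation (orb y 1) * annihilation (orb y 0) * (creation (orb z 0) * creation (orb z 1)) -
        creation (orb z 0) * creation (orb z 1) * (annihilation (orb y 1) * annihilation (orb y 0)) =
      if z = y then -(numberOp y 0 + numberOp y 1 - 1) else 0 := by
  refine Matrix.ext_iff_mulVec.2 fun f => ?_
  have e : (annihilation (orb y 1) * annihilation (orb y 0) * (creation (orb z 0) * creation (orb z 1)) -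
        creation (orb z 0) * creation (orb z 1) * (annihilation (orb y 1) * annihilation (orb y 0))) *ᵥ f =
      (annihilation (orb y 1) * annihilation (orb y 0)) *ᵥ ((creation (orb z 0) * creation (orb z 1)) *ᵥ f) -
        (creation (orb z 0) * creation (orb z 1)) *ᵥ ((annihilation (orb y 1) * annihilation (orb y 0)) *ᵥ f) := by
    rw [sub_mulVec, mulVec_mulVec, mulVec_mulVec]
  rw [e]
  by_cases h : z = y
  · subst h
    rw [if_pos rfl, neg_mulVec, sub_mulVec, add_mulVec, one_mulVec]
    funext s
    rw [Pi.sub_apply, EtaPairingODLRO.pairAnnihilation_pairCreation_self, Pi.neg_apply, Pi.sub_apply,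
      Pi.add_apply, numberOp_mulVec_apply_ind, numberOp_mulVec_apply_ind]
    ring
  · rw [if_neg h, zero_mulVec, EtaPairingODLRO.pairAnnihilation_pairCreation_comm h f, sub_self]

/-- **`[Δ_y, η†_ε] = -ε_y (n_y - 1)`**, i.e. `[η†_ε, Δ_y] = ε_y (n_y - 1) = 2 ε_y J^z_y`: the pseudospin
raising operator rotates the pair annihilator into the charge deviation. Yang–Zhang, Mod. Phys. Lett. B 4
(1990) 759, Theorem 1; Zhang (1990). [cite: YangZhang1990, Theorem 1] [cite: Zhang1990] -/
theorem pairAnnihilation_commutator_etaRaise (ε : Λ → ℤˣ) (y : Λ) :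
    annihilation (orb y 1) * annihilation (orb y 0) * etaRaise ε -
        etaRaise ε * (annihilation (orb y 1) * annihilation (orb y 0)) =
      -(((ε y : ℤ) : ℂ) • (numberOp y 0 + numberOp y 1 - 1)) := by
  rw [commutator_etaRaise]
  simp_rw [pairAnnihilation_commutator_pairCreation]
  rw [Finset.sum_eq_single y (fun z _ hz => by rw [if_neg hz, smul_zero])
    (fun h => absurd (Finset.mem_univ y) h), if_pos rfl, smul_neg]

/-! ### §2 Duhamel pseudospin isotropy: `tr((n_x - 1) W₁ (n_y - 1) W₂) = 2 ε_x ε_y tr(Δ†_x W₁ Δ_y W₂)` -/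

/-- **Component form.** If `W₁`, `W₂` commute with `η†_ε` then for ALL sites `x`, `y`
`tr((n_x - 1) W₁ (n_y - 1) W₂) = 2 ε_x ε_y tr(Δ†_x W₁ Δ_y W₂)` (the Ward identity
`trace_commutator_sandwich_eq_neg` with `A = n_x - 1`, `B = Δ_y` and the commutators of §1). With
`W₁ = e^{-sβK}`, `W₂ = e^{-(1-s)βK}` this is the integrand of the Duhamel function. [cite: Zhang1990]
[cite: KuboKishi1990, proof of Theorem 2] -/
theorem trace_chargeDev_sandwich_eq (ε : Λ → ℤˣ) {W₁ W₂ : Matrix (Finset (Orb Λ)) (Finset (Orb Λ)) ℂ}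
    (h₁ : W₁ * etaRaise ε = etaRaise ε * W₁) (h₂ : W₂ * etaRaise ε = etaRaise ε * W₂) (x y : Λ) :
    ((numberOp x 0 + numberOp x 1 - 1) * W₁ * (numberOp y 0 + numberOp y 1 - 1) * W₂).trace =
      (2 * ((ε x : ℤ) : ℂ) * ((ε y : ℤ) : ℂ)) *
        (creation (orb x 0) * creation (orb x 1) * W₁ * (annihilation (orb y 1) * annihilation (orb y 0)) *
          W₂).trace := by
  have hW := trace_commutator_sandwich_eq_neg h₁ h₂ (numberOp x 0 + numberOp x 1 - 1)
    (annihilation (orb y 1) * annihilation (orb y 0))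
  have hA : etaRaise ε * (numberOp x 0 + numberOp x 1 - 1) - (numberOp x 0 + numberOp x 1 - 1) * etaRaise ε =
      -((2 * ((ε x : ℤ) : ℂ)) • (creation (orb x 0) * creation (orb x 1))) := by
    rw [← chargeDev_commutator_etaRaise, neg_sub]
  have hB : etaRaise ε * (annihilation (orb y 1) * annihilation (orb y 0)) -
      annihilation (orb y 1) * annihilation (orb y 0) * etaRaise ε =
        ((ε y : ℤ) : ℂ) • (numberOp y 0 + numberOp y 1 - 1) := by
    rw [← neg_sub, pairAnnihilation_commutator_etaRaise, neg_neg]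
  rw [hA, hB] at hW
  simp only [Matrix.neg_mul, Matrix.smul_mul, Matrix.mul_smul, trace_neg, trace_smul, smul_eq_mul,
    neg_inj] at hW
  -- `hW : 2ε_x · tr(Δ†_x W₁ Δ_y W₂) = ε_y · tr((n_x-1) W₁ (n_y-1) W₂)`
  calc ((numberOp x 0 + numberOp x 1 - 1) * W₁ * (numberOp y 0 + numberOp y 1 - 1) * W₂).trace
      = ((ε y : ℤ) : ℂ) * (((ε y : ℤ) : ℂ) *
          ((numberOp x 0 + numberOp x 1 - 1) * W₁ * (numberOp y 0 + numberOp y 1 - 1) * W₂).trace) := by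
        rw [← mul_assoc, sign_intCast_mul_self, one_mul]
    _ = ((ε y : ℤ) : ℂ) * (2 * ((ε x : ℤ) : ℂ) *
          (creation (orb x 0) * creation (orb x 1) * W₁ *
            (annihilation (orb y 1) * annihilation (orb y 0)) * W₂).trace) := by rw [hW]
    _ = _ := by ring

/-- **Summed form with real profiles.** If `W₁`, `W₂` commute with `η†_ε` then
`tr(F_a W₁ F_b W₂) = 2 tr(P†_{aε} W₁ P_{bε} W₂)` with `F_a = Σ_x a_x (n_x - 1)` (`chargeDensityField a`),
`P†_{aε} = Σ_x a_x ε_x Δ†_x`, `P_{bε} = Σ_y b_y ε_y Δ_y`. [cite: Zhang1990] [cite: KuboKishi1990, proof of Theorem 2] -/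
theorem trace_chargeDensityField_sandwich_eq (ε : Λ → ℤˣ) {W₁ W₂ : Matrix (Finset (Orb Λ)) (Finset (Orb Λ)) ℂ}
    (h₁ : W₁ * etaRaise ε = etaRaise ε * W₁) (h₂ : W₂ * etaRaise ε = etaRaise ε * W₂) (a b : Λ → ℝ) :
    (chargeDensityField a * W₁ * chargeDensityField b * W₂).trace =
      2 * ((∑ x : Λ, ((a x : ℂ) * ((ε x : ℤ) : ℂ)) • (creation (orb x 0) * creation (orb x 1))) * W₁ *
        (∑ y : Λ, ((b y : ℂ) * ((ε y : ℤ) : ℂ)) • (annihilation (orb y 1) * annihilation (orb y 0))) *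
          W₂).trace := by
  unfold chargeDensityField
  simp only [Finset.sum_mul, Finset.mul_sum, Matrix.smul_mul, Matrix.mul_smul, trace_sum, trace_smul,
    smul_eq_mul]
  refine Finset.sum_congr rfl fun y _ => Finset.sum_congr rfl fun x _ => ?_
  rw [trace_chargeDev_sandwich_eq ε h₁ h₂ x y]
  ring

/-- **Duhamel pseudospin isotropy.** If `η†_ε K = K η†_ε` then for every `β` and all real profiles `a`, `b`
`(F_a, F_b)_{β,K} = 2 (P†_{aε}, P_{bε})_{β,K}`: the charge and the `ε`-twisted on-site pairing susceptibilities
agree up to the factor `2`. (The Gibbs weights `e^{-sβK}` commute with `η†_ε`; apply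
`trace_chargeDensityField_sandwich_eq` under the integral.) [cite: Zhang1990]
[cite: KuboKishi1990, proof of Theorem 2] -/
theorem duhamel_chargeDensityField_eq_two_mul_pair (ε : Λ → ℤˣ) {K : Matrix (Finset (Orb Λ)) (Finset (Orb Λ)) ℂ}
    (hK : etaRaise ε * K = K * etaRaise ε) (β : ℝ) (a b : Λ → ℝ) :
    duhamel β K (chargeDensityField a) (chargeDensityField b) =
      2 * duhamel β K (∑ x : Λ, ((a x : ℂ) * ((ε x : ℤ) : ℂ)) • (creation (orb x 0) * creation (orb x 1)))
        (∑ y : Λ, ((b y : ℂ) * ((ε y : ℤ) : ℂ)) • (annihilation (orb y 1) * annihilation (orb y 0))) := by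
  have hc : ∀ t : ℝ, gibbsWeight t K * etaRaise ε = etaRaise ε * gibbsWeight t K := fun t =>
    ((Commute.smul_left (show Commute K (etaRaise ε) from hK.symm) (-(t : ℂ))).exp_left).eq
  exact duhamel_eq_mul_of_forall_trace_eq fun s => trace_chargeDensityField_sandwich_eq ε (hc _) (hc _) a b

/-- **`(F_{cε}, F_{cε})_{β,K} = 2 (P†_c, P_c)_{β,K}`** for every real profile `c` (`ε_x² = 1`): the
`ε`-twisted charge susceptibility equals twice the on-site pairing susceptibility with the same profile.
[cite: Zhang1990] [cite: KuboKishi1990, proof of Theorem 2] -/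
theorem duhamel_twistedCharge_eq_two_mul_pair (ε : Λ → ℤˣ) {K : Matrix (Finset (Orb Λ)) (Finset (Orb Λ)) ℂ}
    (hK : etaRaise ε * K = K * etaRaise ε) (β : ℝ) (c : Λ → ℝ) :
    duhamel β K (chargeDensityField fun x => c x * ((ε x : ℤ) : ℝ))
        (chargeDensityField fun x => c x * ((ε x : ℤ) : ℝ)) =
      2 * duhamel β K (∑ x : Λ, (c x : ℂ) • (creation (orb x 0) * creation (orb x 1)))
        (∑ y : Λ, (c y : ℂ) • (annihilation (orb y 1) * annihilation (orb y 0))) := by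
  rw [duhamel_chargeDensityField_eq_two_mul_pair ε hK]
  have hcoef : ∀ x : Λ, (((c x * ((ε x : ℤ) : ℝ) : ℝ) : ℂ) * ((ε x : ℤ) : ℂ)) = (c x : ℂ) := fun x => by
    rw [Complex.ofReal_mul, Complex.ofReal_intCast, mul_assoc, sign_intCast_mul_self, mul_one]
  simp_rw [hcoef]

/-- **`(F_ε, F_ε)_{β,K} = 2 (η†_1, η_1)_{β,K}`**: the staggered charge (CDW) susceptibility is twice the
uniform `s`-wave (on-site) pairing susceptibility, `η†_1 = Σ_x Δ†_x`, `η_1 = Σ_y Δ_y = B` (Shastry's uniform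
pair field), in every Gibbs state of a `K` commuting with `η†_ε`. [cite: Zhang1990]
[cite: KuboKishi1990, proof of Theorem 2] -/
theorem duhamel_staggeredCharge_eq_two_mul_etaPair (ε : Λ → ℤˣ)
    {K : Matrix (Finset (Orb Λ)) (Finset (Orb Λ)) ℂ} (hK : etaRaise ε * K = K * etaRaise ε) (β : ℝ) :
    duhamel β K (chargeDensityField fun x => ((ε x : ℤ) : ℝ)) (chargeDensityField fun x => ((ε x : ℤ) : ℝ)) =
      2 * duhamel β K (etaRaise fun _ : Λ => (1 : ℤˣ)) (etaLower fun _ => 1) := by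
  have h := duhamel_twistedCharge_eq_two_mul_pair ε hK β (fun _ => 1)
  simp only [one_mul, Complex.ofReal_one, one_smul] at h
  rw [h, etaRaise, EtaPairingODLRO.etaLower_eq_sum']
  simp only [Units.val_one, Int.cast_one, one_smul]

end CAR

/-! ### §3 Kubo–Kishi (6): the pairing susceptibility bound, proved from the charge Gaussian domination -/

section KuboKishi

variable {Λ : Type} [LinearOrder Λ] [Fintype Λ] (G : SimpleGraph Λ) [DecidableRel G.Adj]

/-- `Re (2 z) = 2 Re z`. [folklore] -/
private theorem re_two_mul (z : ℂ) : ((2 : ℂ) * z).re = 2 * z.re := by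
  simp [Complex.mul_re]

/-- **Kubo–Kishi (6) (PROVED from the named fact `kuboKishi_charge_gaussianDomination`).** For `U > 0`,
`μ = U/2`, a bipartite sign `ε` on the graph `G`, `β > 0` and every real profile `c`:
`Re (P†_c, P_c)_β ≤ Σ_x c_x² /(2βU)`, `P_c = Σ_x c_x c_{x↓} c_{x↑}` — the on-site pairing susceptibility of
the half-filled repulsive Hubbard model is bounded by a constant times `1/U`, uniformly in the temperature and
in the graph (their (5) for the twisted profile `cε`, `Σ (c_x ε_x)² = Σ c_x²`, rotated by the pseudospin
symmetry, `duhamel_twistedCharge_eq_two_mul_pair`). [cite: KuboKishi1990, Theorem 2 eq. (6)] -/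
theorem kuboKishi_pairing_duhamel_le (hKK : kuboKishi_charge_gaussianDomination) (ε : Λ → ℤˣ)
    (hε : ∀ x y, G.Adj x y → ε x = -ε y) {t U β : ℝ} (hU : 0 < U) (hβ : 0 < β) (c : Λ → ℝ) :
    (duhamel β (hamiltonianWith G t U (U / 2)) (∑ x : Λ, (c x : ℂ) • (creation (orb x 0) * creation (orb x 1)))
        (∑ y : Λ, (c y : ℂ) • (annihilation (orb y 1) * annihilation (orb y 0)))).re ≤
      (∑ x, c x ^ 2) / (2 * U) / β := by
  have hb := kuboKishi_charge_duhamel_le G hKK ε hε (t := t) hU hβ (fun x => c x * ((ε x : ℤ) : ℝ))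
  rw [duhamel_twistedCharge_eq_two_mul_pair ε (etaRaise_mul_hamiltonianWith_half G ε hε t U) β c,
    re_two_mul] at hb
  have hsq : ∑ x, (c x * ((ε x : ℤ) : ℝ)) ^ 2 = ∑ x, c x ^ 2 := Finset.sum_congr rfl fun x _ => by
    rw [mul_pow, sq ((ε x : ℤ) : ℝ), ← Int.cast_mul, Int.units_coe_mul_self, Int.cast_one, mul_one]
  rw [hsq] at hb
  have hr : (∑ x, c x ^ 2) / (2 * U) / β = ((∑ x, c x ^ 2) / U / β) / 2 := by ring
  rw [hr]
  linarith

/-- **The uniform case: `Re (η†_1, η_1)_β ≤ |Λ|/(2βU)`** — the `q = 0` on-site `s`-wave pairing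
susceptibility `χ_P = β (B†; B)/|Λ| ≤ 1/(2U)` of the half-filled repulsive Hubbard model on any finite
bipartite-signed graph, at every temperature. [cite: KuboKishi1990, Theorem 2 eq. (6)] -/
theorem kuboKishi_uniformPairing_duhamel_le (hKK : kuboKishi_charge_gaussianDomination) (ε : Λ → ℤˣ)
    (hε : ∀ x y, G.Adj x y → ε x = -ε y) {t U β : ℝ} (hU : 0 < U) (hβ : 0 < β) :
    (duhamel β (hamiltonianWith G t U (U / 2)) (etaRaise fun _ : Λ => (1 : ℤˣ)) (etaLower fun _ => 1)).re ≤
      (Fintype.card Λ : ℝ) / (2 * U) / β := by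
  have h := kuboKishi_pairing_duhamel_le G hKK ε hε (t := t) hU hβ (fun _ => 1)
  simp only [Complex.ofReal_one, one_smul, one_pow, Finset.sum_const, Finset.card_univ, nsmul_eq_mul,
    mul_one] at h
  rw [etaRaise, EtaPairingODLRO.etaLower_eq_sum']
  simpa only [Units.val_one, Int.cast_one, one_smul] using h

variable (d L : ℕ)

/-- **Kubo–Kishi (6) on the torus `(ℤ/Lℤ)^d`, `L` even** (bipartite sign `torusStagger`): for `U > 0`,
`μ = U/2`, `β > 0`, every dimension `d` and every real `t`,
`Re (η†_1, η_1)_β ≤ L^d/(2βU)` for the grand-canonical Hubbard torus `hubbardTorusWith d L t U (U/2)` — the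
uniform on-site pairing susceptibility per site is at most `1/(2U)` at every temperature, in every dimension.
[cite: KuboKishi1990, Theorem 2 eq. (6)] -/
theorem kuboKishi_uniformPairing_duhamel_le_torus (hKK : kuboKishi_charge_gaussianDomination)
    (hL : Even L) {t U β : ℝ} (hU : 0 < U) (hβ : 0 < β) :
    (duhamel β (hubbardTorusWith d L t U (U / 2)) (etaRaise fun _ : FermionTorus d L => (1 : ℤˣ))
        (etaLower fun _ => 1)).re ≤ (Fintype.card (FermionTorus d L) : ℝ) / (2 * U) / β := by
  have hHG : hubbardTorusWith d L t U (U / 2) = hamiltonianWith (fermionTorusGraph d L) t U (U / 2) := rfl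
  rw [hHG]
  -- `convert`: the torus statement carries the structural `DecidableEq` instance on the orbitals, the
  -- generic lemma the one derived from the linear order (equal by `Subsingleton.elim`)
  convert kuboKishi_uniformPairing_duhamel_le (fermionTorusGraph d L) hKK torusStagger
    (fun _ _ h => torusStagger_eq_neg_of_adj_holds hL h) (t := t) hU hβ using 3

end KuboKishi

end Literature.MathematicalPhysics.QuantumLattice
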